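import Mathlib
import HarnessLib
import Literature.Analysis.FluidPDE.ClassicalSolution

/-!
# Route `QuarterLogPincer`, crux `TypeIQuantSubcubicExp` (stmt-NavierStokesRegularity-24077), line `limit_silence` —
# the line's OBJECTS, verbatim (Defs file)

VERBATIM port of the statement sections §T (the target `ThickBoxSilencingCost`, itself the verbatim restatement of
line `silencing_cost`'s Sc′), §L (the limit objects `FailingFamily`, `BackwardVanishingWitness`) and §S (the three stub
STATEMENTS `Normalisation`, `LimitStep`, `NoWitness`) of ns-idea-7's workfile
`Cruxes/TypeIQuantSubcubicExp/Lines/limit_silence.lean` (v1, crux-write commit cc13b3316587; idea-crit-4 g8 verdict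
2026-08-29T06:13Z = PASS), together with its sorry-free KERNEL `thickBoxSilencingCost_of` (§K), so that the stubs can be
landed BY NAME in `Theorems/` (workfile modules are not importable); the only textual change is the unfolding of the
workfile's local notation `E3` into `EuclideanSpace ℝ (Fin 3)` (no notation is declared here).  Same namespace as the workfile
(`…Cruxes.TypeIQuantSubcubicExp.LimitSilence`); the author's line file may delete these declarations and import this
module.  No stub is proved here.  HONEST FRAME: definitions of Props about a parabolic-inequality class and one
three-line implication between them; nothing here bears on 24077's truth, W7 or Navier–Stokes regularity (OPEN / not
proved).  pub-ns-dss typer (g38), `--supports stmt-NavierStokesRegularity-24077`; text by ns-idea-7 (g12).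
-/

set_option linter.dupNamespace false

namespace Summit.NavierStokesRegularity.NavierStokesRegularity.Cruxes.TypeIQuantSubcubicExp.LimitSilence

noncomputable section

open MeasureTheory Set Function Filter Topology Metric
open scoped ENNReal NNReal Classical Laplacian RealInnerProductSpace
open Literature.Analysis Literature.Analysis.FluidPDE

/-! ## §T  The target, restated verbatim -/

/-- TARGET BY NAME (restated VERBATIM from `…Cruxes.TypeIQuantSubcubicExp.SilencingCost.ThickBoxSilencingCost`,
tree `Lines/silencing_cost.lean` commit 338118c44af2, the critic-named NS-free form of idea-crit-7 g6's price
P1): COST OF SILENCING IN A THICK BOX for the parabolic-inequality class.  For every amplitude `B ≥ 1`,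
initial enstrophy `δ > 0` and inner radius `Γ₂ ≥ 1` there are a thickness `K ≥ Γ₂` and a floor
`c ∈ (0, δ]` such that: any jointly smooth `ω` on `[t,t₁] × ℝ³`, `t < t₁ ≤ t + σ²`, obeying on
`B(y,2Kσ) × [t,t₁]` the box bounds `‖ω‖ ≤ Bσ⁻²`, `‖∇ω‖ ≤ Bσ⁻³` and the differential inequality
`‖∂ₛω − Δω‖ ≤ Bσ⁻²‖ω‖ + Bσ⁻¹‖∇ω‖`, with `∫_{B(y,Γ₂σ)}‖ω(t)‖² ≥ δ/σ`, still has
`∫_{B(y,Kσ)}‖ω(t₁)‖² ≥ c/σ`. -/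
def ThickBoxSilencingCost : Prop :=
  ∀ B δ Γ₂ : ℝ, 1 ≤ B → 0 < δ → 1 ≤ Γ₂ → ∃ K c : ℝ, Γ₂ ≤ K ∧ 0 < c ∧ c ≤ δ ∧
    ∀ (ω : ℝ → (EuclideanSpace ℝ (Fin 3)) → (EuclideanSpace ℝ (Fin 3))) (y : (EuclideanSpace ℝ (Fin 3)))
      (σ t t₁ : ℝ),
      0 < σ → t < t₁ → t₁ ≤ t + σ ^ 2 →
      IsSmoothSpaceTimeOn (Icc t t₁) ω →
      (∀ s ∈ Icc t t₁, ∀ x ∈ ball y (2 * K * σ),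
        ‖ω s x‖ ≤ B * σ ^ (-(2 : ℝ)) ∧ ‖fderiv ℝ (ω s) x‖ ≤ B * σ ^ (-(3 : ℝ)) ∧
        ‖timeDerivWithin (Icc t t₁) ω s x - (Δ (ω s)) x‖ ≤
          B * σ ^ (-(2 : ℝ)) * ‖ω s x‖ + B * σ ^ (-(1 : ℝ)) * ‖fderiv ℝ (ω s) x‖) →
      ENNReal.ofReal (δ / σ) ≤ ∫⁻ x in ball y (Γ₂ * σ), ‖ω t x‖ₑ ^ 2 →
      ENNReal.ofReal (c / σ) ≤ ∫⁻ x in ball y (K * σ), ‖ω t₁ x‖ₑ ^ 2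

/-! ## §L  The limit objects -/

/-- The NORMALISED FAILING FAMILY (output of L1a, input of L1b): what the negation of
`ThickBoxSilencingCost` provides after the parabolic rescaling `ω̃(s,z) = σ² ω(t + σ² s, y + σ z)` — fixed
`B ≥ 1`, `δ > 0`, `Γ₂ ≥ 1` and, for every `n : ℕ`, a jointly smooth `ω` on `[0,s₁] × ℝ³` with span
`0 < s₁ ≤ 1`, obeying the UNIT-SCALE box bounds and differential inequality on the growing ball
`B(0, 2(Γ₂+n)) × [0,s₁]`, with initial enstrophy `≥ δ` on `B(0,Γ₂)` and final enstrophy `< 1/(n+1)` on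
`B(0, Γ₂+n)`. -/
def FailingFamily : Prop :=
  ∃ B δ Γ₂ : ℝ, 1 ≤ B ∧ 0 < δ ∧ 1 ≤ Γ₂ ∧ ∀ n : ℕ,
    ∃ (ω : ℝ → (EuclideanSpace ℝ (Fin 3)) → (EuclideanSpace ℝ (Fin 3))) (s₁ : ℝ), 0 < s₁ ∧ s₁ ≤ 1 ∧
    IsSmoothSpaceTimeOn (Icc 0 s₁) ω ∧
    (∀ s ∈ Icc 0 s₁, ∀ x ∈ ball (0 : (EuclideanSpace ℝ (Fin 3))) (2 * (Γ₂ + n)),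
      ‖ω s x‖ ≤ B ∧ ‖fderiv ℝ (ω s) x‖ ≤ B ∧
      ‖timeDerivWithin (Icc 0 s₁) ω s x - (Δ (ω s)) x‖ ≤ B * ‖ω s x‖ + B * ‖fderiv ℝ (ω s) x‖) ∧
    ENNReal.ofReal δ ≤ ∫⁻ x in ball (0 : (EuclideanSpace ℝ (Fin 3))) Γ₂, ‖ω 0 x‖ₑ ^ 2 ∧
    ∫⁻ x in ball (0 : (EuclideanSpace ℝ (Fin 3))) (Γ₂ + n), ‖ω s₁ x‖ₑ ^ 2 < ENNReal.ofReal (1 / ((n : ℝ) + 1))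

/-- A BACKWARD-VANISHING WITNESS (output of L1b, excluded by L2): constants `B ≥ 0`, `S > 0`, a vector
field `ω : ℝ → ℝ³ → ℝ³` and a source `F` such that `ω` is jointly continuous, bounded by `B`, `B`-Lipschitz
in space at every time; `F` is measurable with the unique-continuation bound
`‖F(s,x)‖ ≤ B (‖ω(s,x)‖ + ‖∇ω(s,x)‖)` for a.e. `(s,x)` with `s ∈ (0,S)` (`∇ω` = `fderiv`, which exists a.e.
by Rademacher); the heat equation `(∂ₛ − Δ)ω = F` holds IN THE SENSE OF DISTRIBUTIONS on `(0,S) × ℝ³`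
(tested against jointly smooth, compactly supported `φ` vanishing outside the time interval `(0,S)`:
`∫∫ ⟪ω, −∂ₛφ − Δφ⟫ = ∫∫ ⟪F, φ⟫`); `ω` VANISHES IDENTICALLY at time `S` and is NOT identically zero at
time `0`.  Backward uniqueness [ESS 2003; Seregin 2014 Thm 3.5] says no such object exists (L2). -/
def BackwardVanishingWitness : Prop :=
  ∃ (B S : ℝ) (ω F : ℝ → (EuclideanSpace ℝ (Fin 3)) → (EuclideanSpace ℝ (Fin 3))), 0 ≤ B ∧ 0 < S ∧
    Continuous (uncurry ω) ∧
    (∀ s x, ‖ω s x‖ ≤ B) ∧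
    (∀ s, LipschitzWith (Real.toNNReal B) (ω s)) ∧
    Measurable (uncurry F) ∧
    (∀ᵐ q : ℝ × (EuclideanSpace ℝ (Fin 3)), q.1 ∈ Ioo 0 S →
      ‖F q.1 q.2‖ ≤ B * (‖ω q.1 q.2‖ + ‖fderiv ℝ (ω q.1) q.2‖)) ∧
    (∀ φ : ℝ → (EuclideanSpace ℝ (Fin 3)) → (EuclideanSpace ℝ (Fin 3)), IsSmoothSpaceTimeOn univ φ →
      HasCompactSupport (uncurry φ) →
      (∀ s, s ∉ Ioo 0 S → ∀ x, φ s x = 0) →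
      ∫ q : ℝ × (EuclideanSpace ℝ (Fin 3)), ⟪ω q.1 q.2, -(deriv (fun s => φ s q.2) q.1) - (Δ (φ q.1)) q.2⟫ =
        ∫ q : ℝ × (EuclideanSpace ℝ (Fin 3)), ⟪F q.1 q.2, φ q.1 q.2⟫) ∧
    (∀ x, ω S x = 0) ∧ (∃ x, ω 0 x ≠ 0)

/-! ## §S  The three stub statements (named, so that BC7 probes and the critic address them by name) -/

/-- L1a statement: NORMALISATION — the negation of the target yields a normalised failing family. -/
def Normalisation : Prop := ¬ ThickBoxSilencingCost → FailingFamily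

/-- L1b statement: COMPACTNESS — a normalised failing family yields a backward-vanishing witness. -/
def LimitStep : Prop := FailingFamily → BackwardVanishingWitness

/-- L2 statement: BACKWARD UNIQUENESS [ESS 2003; Seregin 2014 Thm 3.5] — no backward-vanishing witness. -/
def NoWitness : Prop := ¬ BackwardVanishingWitness

/-! ## §K  Kernel (proved) -/

/-- KERNEL: compactness–rigidity closure.  `ThickBoxSilencingCost` follows from the three stubs by
contradiction. -/
theorem thickBoxSilencingCost_of
    (h₁ : Normalisation) (h₂ : LimitStep) (h₃ : NoWitness) : ThickBoxSilencingCost := by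
  by_contra h
  exact h₃ (h₂ (h₁ h))

end

end Summit.NavierStokesRegularity.NavierStokesRegularity.Cruxes.TypeIQuantSubcubicExp.LimitSilence
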